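import Summits.ABC.IUTFork.Cor312CapstoneWitness
import HarnessLib

/-!
# TEAM B capstone witness, part B: the twelve side conditions discharged, the residual input fails

Record-only, proof-side companion (D-0012) of `Cor312CapstoneWitness` (abc-iut cell, Cor. 3.12
STRATEGY TEAM B «estimate / log-Kummer», HUMAN RULING D-0067 (3), seat abc-iut-c312-11 = B1; second
half of the answer to audit note N2 of seat w5-d155 on p413800, STATUS 2026-08-26T00:31:07Z); TAKES
NO SIDE. Part A built `haarFull` (typed Theorem 3.11 TRUE over the honest `ZMod 4` Haar container
`Lam4`/`eMap`); THIS file puts the verbatim `Cor312.Setting` on it and closes N2: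

* `haarSetting` — Θ-pilot Kummer images `{0}` (volume `1/4`), `q`-pilot image everything (volume
  `1/2`), hull frame `{{0}, univ}`; `−|log(Θ)| = log(1/4)`, `−|log(q)| = log(1/2)`
  (`haar_negLogTheta`/`haar_negLogQ`).
* `haarSetting_bridgeHyps` / `haarSetting_thetaRegionsAdm` / `haarSetting_absLogQPos` — every bridge
  hypothesis, admissibility of the Kummer images, and `|log(q)| > 0` (the witness is not
  sign-degenerate) — while the typed Corollary 3.12 FAILS (`haarSetting_not_statement`).
* `capstone_at` — **the TEAM B capstone INSTANTIATED at the witness**: every one of its twelve side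
  conditions is discharged for the Haar data (`hlogvol`/`hAdm` by `rfl`/`Iff.rfl` — the data of part
  A is DEFINED through the container; `hInd`/`hψ` by the identity homeomorphism carrying `Λ` onto
  itself; `hthetaEq`/`hR` from the reference region `{0}`), leaving exactly
  `QFrobEqualityAt haarSetting 0 → haarSetting.Statement` — the kernel certificate that the
  capstone's premise set is JOINTLY SATISFIABLE.
* `haarSetting_not_qFrobEqualityAt` / `haarSetting_not_qFrobComparison` — at the SAME witness the
  residual input fails at EVERY lattice position, and so does its `≤`-form.
* `capstonePremises_not_imp_qFrobEqualityAt` — the ∃-form: the capstone's premise set is jointly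
  satisfiable, non-trivialising, and consistent with `¬(B-INPUT)` — **(G3) independence lifted from
  the route-level premise set to the capstone's own premise set** (w5-d155 N2 repaired).

HONEST SCOPE: interface-level, toy carriers — this says the capstone's premise set does not FORCE the
residual comparison or the Statement; whether the comparison holds for the ASSEMBLED real setting
from the frozen definitions + FACT-LIST is exactly GAP row G-c312-11-1, not decided here. Sources:
[IUTchIII] pp. 173–175, p. 184 l. 30–34 (Step (xi-g)). [claim: Mochizuki2012, status: disputed]
[cite: MochizukiAbsTopIII2015, Prop. 5.7 (i) pp. 137–138] [cite: ScholzeStix2018, §2.2 pp. 9–10]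
Deliberately NOT here: any real-setting discharge, any judgement on Cor. 3.12 or its gap rows.
-/

noncomputable section

namespace Summit.ABC

namespace IUTFork

namespace Cor312Vol

namespace CapstoneWitness

open Thm311 Cor312 Cor312.Checks Cor312Vol.GapWitness Literature.IUT.LogVolume
  Literature.IUT.LogThetaLattice MeasureTheory Set
open scoped ENNReal Pointwise

/-! ## 4. The setting: Θ-pilot Kummer images `{0}`, `q`-pilot image everything -/

/-- The SETTING of the witness over `haarSituation`: lattice `^{n,m}𝓗𝓣 := (n, m)`, one-point pilots,
hull frame `{{0}, univ}` (the Team A gap frame — both hull-sets `HaarAdm`-admissible); the Θ-pilot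
Kummer image is `{0}` at every `m`, the `q`-pilot image is everything. [folklore] -/
def haarSetting : Setting haarSituation where
  n := 0
  HT := ℤ × ℤ
  LogLink := fun _ _ => Unit
  IsFull := fun _ => True
  lattice :=
    { theater := fun n m => (n, m)
      distinct := fun p q h => by simpa using h
      logLink := fun _ _ => ()
      logLink_full := fun _ _ => trivial }
  Frd := Unit
  IsoF := fun _ _ => Unit
  Ob := fun _ => Unit
  realify := id
  Strip := Unit
  IsoS := fun _ _ => Unit
  M := fun _ _ => Unit
  sig := toySig
  split := { Msplit := fun _ _ => ⊤, exists_gen := fun _ _ => ⟨⟨(), trivial⟩, top_unit_isGenerator _⟩ }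
  ObΔ := Unit
  N := fun _ _ => Unit
  qData := { q := fun _ _ => (), q_gen := fun _ _ => unit_isGenerator _, objOf := fun _ => () }
  frame := fun j vQ => gapFrame _
  hul_adm := fun j vQ H hH => by
    rcases hH with rfl | rfl
    · exact (haarAdm_iff_nonempty j vQ _).2 ⟨0, rfl⟩
    · exact (haarAdm_iff_nonempty j vQ _).2 ⟨0, Set.mem_univ 0⟩
  thetaRegionOf := fun _ _ _ _ => {0}
  qRegionOf := fun _ _ _ => Set.univ
  qRegion_mem := fun _ _ => Set.mem_insert_of_mem _ rfl
  qSupport_finite := fun _ => Set.toFinite _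

/-- The (Ind3)-enlarged Θ-pilot region is `{0}` in every packet. [folklore] -/
theorem haar_thetaRegion3 (j : toyIndex.Label) (vQ : toyIndex.VQ) :
    haarSetting.thetaRegion3 j vQ = {0} := by
  show (⋃ _ : ℤ, ({0} : Set (toyShells.Packet j vQ))) = {0}
  exact Set.iUnion_const _

/-- The possible images of the Θ-pilot object are exactly `{0}` (every indeterminacy is `ℚ`-linear,
hence fixes `0`). [folklore] -/
theorem haar_mem_possibleImages_iff (j : toyIndex.Label) (vQ : toyIndex.VQ)
    (U : Set (toyShells.Packet j vQ)) :
    U ∈ haarSetting.possibleImages j vQ ↔ U = {0} := by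
  constructor
  · rintro ⟨Φ, -, rfl⟩
    rw [haar_thetaRegion3, Set.image_singleton, map_zero]
    rfl
  · rintro rfl
    exact haar_thetaRegion3 j vQ ▸ haarSetting.thetaRegion3_mem_possibleImages j vQ

/-- The union of the possible images is `{0}`. [folklore] -/
theorem haar_sUnion_possibleImages (j : toyIndex.Label) (vQ : toyIndex.VQ) :
    ⋃₀ haarSetting.possibleImages j vQ = ({0} : Set (toyShells.Packet j vQ)) := by
  ext x
  simp only [Set.mem_sUnion]
  constructor
  · rintro ⟨U, hU, hx⟩
    rwa [(haar_mem_possibleImages_iff j vQ U).1 hU] at hx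
  · intro hx
    exact ⟨{0}, (haar_mem_possibleImages_iff j vQ _).2 rfl, hx⟩

/-- The packet hull `^{n,∘}𝒰_{j,v_ℚ}` of the witness is `{0}`. [folklore] -/
theorem haar_thetaHull (j : toyIndex.Label) (vQ : toyIndex.VQ) :
    haarSetting.thetaHull j vQ = ({0} : Set (toyShells.Packet j vQ)) := by
  refine Set.Subset.antisymm ?_ ?_
  · show (gapFrame _).hull (⋃₀ haarSetting.possibleImages j vQ) ⊆ {0}
    exact gapFrame_hull_of_subset (haar_sUnion_possibleImages j vQ).le
  · exact ((haar_sUnion_possibleImages j vQ).symm.le).trans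
      ((gapFrame (toyShells.Packet j vQ)).subset_hull (⋃₀ haarSetting.possibleImages j vQ))

/-- Every union of possible images admits its hull (the gap frame bounds everything). [folklore] -/
theorem haar_hullDefined (j : toyIndex.Label) (vQ : toyIndex.VQ) :
    haarSetting.HullDefined j vQ := ⟨trivial, trivial⟩

/-- The local Θ-contribution is `log(1/4)` in every packet. [folklore] -/
theorem haar_thetaLocal (j : toyIndex.Label) (vQ : toyIndex.VQ) :
    haarSetting.thetaLocal j vQ = ((Real.log 4⁻¹ : ℝ) : WithTop ℝ) := by
  unfold Setting.thetaLocal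
  rw [if_pos (haar_hullDefined j vQ)]
  show ((haarVol j vQ (haarSetting.thetaHull j vQ) : ℝ) : WithTop ℝ) = _
  rw [haar_thetaHull, haarVol_zero]

/-- The local `q`-contribution is `log(1/2)` in every packet. [folklore] -/
theorem haar_qLocal (j : toyIndex.Label) (vQ : toyIndex.VQ) :
    haarSetting.qLocal j vQ = Real.log 2⁻¹ :=
  haarVol_univ j vQ

/-- The witness is `ThetaFinite`. [folklore] -/
theorem haar_thetaFinite : haarSetting.ThetaFinite :=
  ⟨fun i vQ => by rw [haar_thetaLocal]; exact WithTop.coe_ne_top, fun _ => Set.toFinite _⟩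

/-- `−|log(Θ)| = log(1/4)` at the witness. [folklore] -/
theorem haar_negLogTheta : haarSetting.negLogTheta = ((Real.log 4⁻¹ : ℝ) : WithTop ℝ) := by
  unfold Setting.negLogTheta
  rw [if_pos haar_thetaFinite]
  have h : ∀ i : Fin toyIndex.lstar,
      (∑ᶠ vQ : toyIndex.VQ, (haarSetting.thetaLocal (Setting.labelSucc i) vQ).untopD 0) =
        Real.log 4⁻¹ := by
    intro i
    have h1 : (fun vQ : toyIndex.VQ =>
        (haarSetting.thetaLocal (Setting.labelSucc i) vQ).untopD 0) = fun _ => Real.log 4⁻¹ := by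
      funext vQ
      rw [haar_thetaLocal, WithTop.untopD_coe]
    rw [h1, finsum_unique]
  simp only [h]
  exact congrArg _ (processionNormalized_const (by decide) _)

/-- `−|log(q)| = log(1/2)` at the witness. [folklore] -/
theorem haar_negLogQ : haarSetting.negLogQ = Real.log 2⁻¹ := by
  unfold Setting.negLogQ
  have h : ∀ i : Fin toyIndex.lstar,
      (∑ᶠ vQ : toyIndex.VQ, haarSetting.qLocal (Setting.labelSucc i) vQ) = Real.log 2⁻¹ := by
    intro i
    have h1 : (fun vQ : toyIndex.VQ => haarSetting.qLocal (Setting.labelSucc i) vQ) =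
        fun _ => Real.log 2⁻¹ := by
      funext vQ
      exact haar_qLocal _ vQ
    rw [h1, finsum_unique]
  simp only [h]
  exact processionNormalized_const (by decide) _

/-! ## 5. Bridge hypotheses, admissibility, positivity — and the Corollary fails -/

/-- All bridge hypotheses hold at the witness (genuine Haar monotonicity; possible images `{0}`
admissible; hull-sets and Θ-regions nonempty; `ThetaFinite`). [folklore] -/
theorem haarSetting_bridgeHyps : BridgeHyps haarSetting where
  mono := fun i vQ A B hA hB hAB => haarVol_mono hA hB hAB
  image_adm := fun i vQ U hU => by
    rw [(haar_mem_possibleImages_iff _ vQ U).1 hU]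
    exact (haarAdm_iff_nonempty _ vQ _).2 ⟨0, rfl⟩
  image_fin := fun _ => Set.toFinite _
  hul_nonempty := fun j vQ H hH => by
    rcases hH with rfl | rfl
    · exact ⟨0, rfl⟩
    · exact ⟨0, Set.mem_univ 0⟩
  theta_nonempty := fun i vQ => by
    rw [haar_thetaRegion3]
    exact ⟨0, rfl⟩
  finite := haar_thetaFinite

/-- The Kummer images of the Θ-pilot object are admissible at the witness. [folklore] -/
theorem haarSetting_thetaRegionsAdm : ThetaRegionsAdm haarSetting := fun _ _ vQ =>
  (haarAdm_iff_nonempty _ vQ _).2 ⟨0, rfl⟩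

/-- `|log(q)| > 0` at the witness (`−|log(q)| = log(1/2) < 0` — the witness is not sign-degenerate).
[folklore] -/
theorem haarSetting_absLogQPos : haarSetting.AbsLogQPos := by
  show haarSetting.negLogQ < 0
  rw [haar_negLogQ]
  exact log_half_neg

/-- **The typed Corollary 3.12 FAILS at the witness**: `−|log(Θ)| = log(1/4) < log(1/2) = −|log(q)|`.
[folklore] -/
theorem haarSetting_not_statement : ¬ haarSetting.Statement := by
  rintro ⟨-, hle⟩
  rw [haar_negLogQ, haar_negLogTheta, WithTop.coe_le_coe] at hle
  exact absurd hle (not_le.2 log_quarter_lt_log_half)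

/-! ## 6. The capstone instantiated: all twelve side conditions discharged for the Haar data -/

/-- **The TEAM B capstone applies at the witness**: every one of its twelve side conditions is
discharged for the honest Haar data (`W = ZMod 4`, `Λ = ⊤`, `d = 1`, `e = eMap`, `ψ = id`,
reference regions `R = {0}`) and the typed Theorem 3.11 holds, leaving exactly
`QFrobEqualityAt haarSetting 0 → haarSetting.Statement`. This is the kernel certificate that the
capstone's premise set is JOINTLY SATISFIABLE. [claim: Mochizuki2012, status: disputed] -/
theorem capstone_at :
    QFrobEqualityAt (S' := haarFull.toLatticeSituation) haarSetting 0 → haarSetting.Statement := by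
  intro hQ
  refine teamB_capstone_of_latticeRealisations (S'' := haarFull) haarSetting
    (W := fun _ _ => ZMod 4) (fun _ _ => Lam4) (fun _ _ => 1) eMap
    (fun _ _ _ => ContinuousAddEquiv.refl (ZMod 4)) (fun _ _ => {0})
    (fun j vQ A => rfl) (fun j vQ A => Iff.rfl) ?_ ?_ ?_ ?_
    (fun i vQ A B hA hB hAB => haarVol_mono hA hB hAB) ?_ (fun _ => Set.toFinite _) ?_ ?_
    haar_thetaFinite haarFull_statement hQ
  · -- hInd: each (Ind1)/(Ind2) generator is realised by the identity homeomorphism, which maps the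
    -- integral structure onto itself; `eMap` intertwines because linear equivalences fix `0`.
    intro Φ hΦ j vQ
    refine ⟨ContinuousAddEquiv.refl (ZMod 4), Lam4, by simp, fun x => ?_⟩
    show eMap j vQ (Φ j vQ x) = eMap j vQ x
    exact eMap_comp_linearEquiv (Φ j vQ) x
  · -- hψ: the identity maps the integral structure onto itself.
    intro m j vQ
    exact ⟨Lam4, by simp⟩
  · -- hthetaEq: every Kummer image `{0}` is the identity image of the reference region `{0}`.
    intro m i vQ
    show eMap _ vQ '' ({0} : Set (toyShells.Packet _ vQ)) =
      ⇑(ContinuousAddEquiv.refl (ZMod 4)) '' (eMap _ vQ '' ({0} : Set (toyShells.Packet _ vQ)))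
    rw [eMap_image_zero]
    simp
  · -- hR: the reference regions have positive finite volume.
    intro i vQ
    exact Lam4_haar_pos_lt_top (Set.image_nonempty.2 ⟨0, rfl⟩)
  · -- h3adm: the (Ind3)-enlarged regions are admissible.
    intro i vQ
    exact Lam4_haar_pos_lt_top (Set.image_nonempty.2 ⟨0, Set.mem_iUnion.2 ⟨0, rfl⟩⟩)
  · -- hulne: hull-sets are nonempty.
    exact haarSetting_bridgeHyps.hul_nonempty
  · -- h3ne: the (Ind3)-enlarged regions are nonempty.
    exact haarSetting_bridgeHyps.theta_nonempty

/-! ## 7. The residual input fails at the witness, at every lattice position -/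

/-- **The residual B-INPUT (printed uniform equality form) FAILS at the witness at EVERY lattice
position `m`**: the `q`-pilot reading is `log(1/2)`, every Kummer-image reading is `log(1/4)`.
[folklore] -/
theorem haarSetting_not_qFrobEqualityAt (m : ℤ) :
    ¬ QFrobEqualityAt (S' := haarFull.toLatticeSituation) haarSetting m := by
  intro h
  -- the holomorphic readings are definitionally `haarVol`, the regions definitionally `univ`/`{0}`
  have h0 : haarVol (Setting.labelSucc ⟨0, by decide⟩) () Set.univ =
      haarVol (Setting.labelSucc ⟨0, by decide⟩) ()
        ({0} : Set (toyShells.Packet (Setting.labelSucc ⟨0, by decide⟩) ())) :=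
    h ⟨0, by decide⟩ ()
  rw [haarVol_univ, haarVol_zero] at h0
  exact absurd h0 log_quarter_lt_log_half.ne'

/-- The `≤`-form (`QFrobComparison`, the route's pointwise residual input) fails at the witness too.
[folklore] -/
theorem haarSetting_not_qFrobComparison :
    ¬ QFrobComparison (S' := haarFull.toLatticeSituation) haarSetting := by
  intro h
  obtain ⟨m, hm⟩ := h ⟨0, by decide⟩ ()
  -- the holomorphic readings are definitionally `haarVol`, the regions definitionally `univ`/`{0}`
  have hm' : haarVol (Setting.labelSucc ⟨0, by decide⟩) () Set.univ ≤
      haarVol (Setting.labelSucc ⟨0, by decide⟩) ()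
        ({0} : Set (toyShells.Packet (Setting.labelSucc ⟨0, by decide⟩) ())) := hm
  rw [haarVol_univ, haarVol_zero] at hm'
  exact absurd hm' (not_le.2 log_quarter_lt_log_half)

/-! ## 8. The ∃-form: (G3) independence at the capstone's own premise level -/

/-- **(G3) FOR THE CAPSTONE PREMISE SET (w5-d155 audit note N2 on p413800, repaired).** There is an
instantiation carrying honest Haar realisation data in which the TEAM B capstone's ENTIRE premise set
is satisfied — the typed Theorem 3.11 (i) ∧ (ii) ∧ (iii) in full and all twelve Haar side conditions,
witnessed by the instantiated capstone implication — together with every bridge hypothesis,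
`|log(q)| > 0` and `ThetaRegionsAdm`, while the residual input `QFrobEqualityAt` FAILS at every
lattice position, its `≤`-form `QFrobComparison` FAILS, and the typed Corollary 3.12 FAILS. Hence the
capstone's premise set is jointly satisfiable, does not trivialise the Corollary, and does not entail
its own residual input: the (G1)/(G3) pair of GAP row G-c312-11-1 is consistent at the capstone's own
premise level, not only at the route level. Whether the residual input holds for the ASSEMBLED real
setting is the row's open question, not decided here. [folklore] -/
theorem capstonePremises_not_imp_qFrobEqualityAt :
    ∃ (T : ThetaIndex) (F : FullSituation T) (P : Cor312.Setting F.toLatticeSituation.toSituation),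
      F.Statement ∧ BridgeHyps P ∧ P.AbsLogQPos ∧ ThetaRegionsAdm P ∧
        (QFrobEqualityAt (S' := F.toLatticeSituation) P 0 → P.Statement) ∧
        (∀ m : ℤ, ¬ QFrobEqualityAt (S' := F.toLatticeSituation) P m) ∧
        ¬ QFrobComparison (S' := F.toLatticeSituation) P ∧ ¬ P.Statement :=
  ⟨toyIndex, haarFull, haarSetting, haarFull_statement, haarSetting_bridgeHyps,
    haarSetting_absLogQPos, haarSetting_thetaRegionsAdm, capstone_at,
    haarSetting_not_qFrobEqualityAt, haarSetting_not_qFrobComparison, haarSetting_not_statement⟩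

end CapstoneWitness

end Cor312Vol

end IUTFork

end Summit.ABC

end
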